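import Summits.CriticalPhenomena.PercolationContinuityZ3.Theorems.Transplant.SqShadowVRouteData
import HarnessLib

/-!
# SQUARE SHADOWS — SHAPED LOCAL LINKAGE WITH THE EXIT PROPERTY OF THE WITNESS (the node `ShapedLinkageX R` for THIN instances)

builds on p205010 (kernel theorem, internal audit signed; external expert review pending) — NOT used in this file.  Lane `prim-bschramm`, seat `prim-bschramm-p2` (gen 42; class C1b;
memo `HOME/bschramm/P2-LATTICES.md` §148); helper file (`--supports stmt-CriticalPhenomena-4575 --as helper`).

WHY.  The instance obligation `ShapedLinkage R` («SqShadowVRouteData») quantifies over every exit vertex `w' ∈ W` off three columns.  For THIN square-shadow graphs (the diamond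
films `D_4`, `D_6`: fibres of one or two vertices, vertices of degree `2`) this is unsatisfiable: an interior `w'` adjacent to two boundary terminals forces the rerouted chain
(memo §148, the computation `d4link`).  What the generic routing («SqShadowVRouting») actually produces is sharper: `w'` is the LAST vertex of the `(P2)`-witness `π` in `W`, so —
unless `π` ends inside `W`, a case the routing handles separately — `w'` has a neighbour `x ∉ W` (the next vertex of `π`) inside the cleared window `{ξ ≤ ξ(z) + t_D, η ≤ η(z) + s_D}`
and off the columns of `γ_min ⊇ {z, E₁, E₂}`.  This file records that EXIT PROPERTY as an extra field:
* §1 **`SqShadow.TerminalsX`** (`Terminals` + the exit neighbour) and the node **`SqShadow.ShapedLinkageX R`** (the same swap-pair obligation, for `TerminalsX`-certified triples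
  only); `shapedLinkageX_of_shapedLinkage` (the old node implies the new one);
* §2 `exists_W_of_shapedLinkageX` (the keyed routing from the swap pair).
The consumer is «SqShadowVRoutingX».  Internal obligations, never asserted.
[cite: DuminilCopinSidoraviciusTassion2016, §2.3 (proof of Fact 2: "Choose w' on the boundary of B̄_R in such a way that there exists an open self-avoiding path π from w' to
S̄'_n, all the edges of which lie outside B̄_R(z)")]
-/

noncomputable section

namespace Summit.CriticalPhenomena.PercolationContinuityZ3.Theorems.Transplant

open MeasureTheory Literature.Probability.Percolation Literature.Probability.LatticeModels SimpleGraph Filter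
open scoped Classical Topology

/-! ## §1 Terminals with the exit property; the node -/

/-- **The terminal data WITH THE EXIT PROPERTY of `w'`**: `Terminals R z t_R t_D s_R W E₁ E₂ w'` and a neighbour `x ∉ W` of `w'` over the cleared window
`{ξ ≤ ξ(z) + t_D} ∩ {η ≤ η(z) + s_D}`, off the columns of `z`, `E₁`, `E₂` (DST: `w'` on the boundary of `B̄_R(z)`, the path `π` leaving the ball at once).
[cite: DuminilCopinSidoraviciusTassion2016, §2.3 (proof of Fact 2: u', v', w' and the path π)] -/
structure SqShadow.TerminalsX {V : Type} {G : SimpleGraph V} (Ψ : SqShadow G) (R : ℕ) (z : Site 2) (tR tD sR sD : ℕ) (W : Set V) (E₁ E₂ w' : V) : Prop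
    extends Ψ.Terminals R z tR tD sR W E₁ E₂ w' where
  w'x : ∃ x : V, G.Adj w' x ∧ x ∉ W ∧ SqShadow.InWin z tD sD (Ψ.sh x) ∧ Ψ.sh x ≠ z ∧ Ψ.sh x ≠ Ψ.sh E₁ ∧ Ψ.sh x ≠ Ψ.sh E₂

/-- **NODE (instance obligation) — SHAPED LOCAL LINKAGE with surgery radius `R`, EXIT form.**  As `ShapedLinkage R`, but the swap pair is owed only for terminal triples
certified by `TerminalsX` (the exit vertex `w'` has a neighbour outside the cleared set, inside the cleared window, off the columns of `z, E₁, E₂`).  Internal obligation,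
never asserted; aimed at the thin diamond films (memo §148).  Consumer: «SqShadowVRoutingX». [cite: DuminilCopinSidoraviciusTassion2016, §2.3 (proof of Fact 2, p. 6: the choice of R)] -/
def SqShadow.ShapedLinkageX {V : Type} {G : SimpleGraph V} (Ψ : SqShadow G) (R : ℕ) : Prop :=
  ∀ (z : Site 2) (tR tD sR sD : ℕ), tR ≤ tD → sR ≤ sD → (R ≤ tR ∨ R ≤ sR) →
    ∃ W : Set V, (∀ x ∈ W, Ψ.sh x ∈ sqBlkR R z tD sD) ∧ (∀ x, Ψ.sh x ∈ sqBall z 1 → Ψ.sh x ∈ sqBlkR R z tD sD → x ∈ W) ∧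
      ∀ (E₁ E₂ w' : V), Ψ.TerminalsX R z tR tD sR sD W E₁ E₂ w' →
        ∃ r₁ r₂ : VRouteData G (W ∩ Ψ.lift (sqBlkR R z tR sR)) W E₁ E₂ w', r₁.y = r₂.b ∧ r₁.b = r₂.y

namespace SqShadow

variable {V : Type} {G : SimpleGraph V} (Ψ : SqShadow G)

/-- The node `ShapedLinkage R` implies its exit form (forget the exit neighbour). [folklore] -/
theorem shapedLinkageX_of_shapedLinkage {R : ℕ} (hL : Ψ.ShapedLinkage R) : Ψ.ShapedLinkageX R := by
  intro z tR tD sR sD htRD hsRD hone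
  obtain ⟨W, hW1, hW2, hW3⟩ := hL z tR tD sR sD htRD hsRD hone
  exact ⟨W, hW1, hW2, fun E₁ E₂ w' hT => hW3 E₁ E₂ w' hT.toTerminals⟩

/-! ## §2 The keyed routing from a swap pair -/

/-- **The cleared set and the keyed routing under `ShapedLinkageX`.** [cite: DuminilCopinSidoraviciusTassion2016, §2.3, proof of Fact 2] -/
theorem exists_W_of_shapedLinkageX [Countable V] {R : ℕ} (hL : Ψ.ShapedLinkageX R) (z : Site 2) {tR tD sR sD : ℕ} (htRD : tR ≤ tD) (hsRD : sR ≤ sD)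
    (hone : R ≤ tR ∨ R ≤ sR) :
    ∃ W : Set V, (∀ x ∈ W, Ψ.sh x ∈ sqBlkR R z tD sD) ∧ (∀ x, Ψ.sh x ∈ sqBall z 1 → Ψ.sh x ∈ sqBlkR R z tD sD → x ∈ W) ∧
      ∀ (E₁ E₂ w' : V), Ψ.TerminalsX R z tR tD sR sD W E₁ E₂ w' →
        ∃ r : VRouteData G (W ∩ Ψ.lift (sqBlkR R z tR sR)) W E₁ E₂ w', vtxKey V r.y < vtxKey V r.b := by
  obtain ⟨W, hW1, hW2, hW3⟩ := hL z tR tD sR sD htRD hsRD hone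
  refine ⟨W, hW1, hW2, fun E₁ E₂ w' hT => ?_⟩
  obtain ⟨r₁, r₂, hy, hb⟩ := hW3 E₁ E₂ w' hT
  exact VRouteData.exists_key r₁ r₂ hy hb

end SqShadow

end Summit.CriticalPhenomena.PercolationContinuityZ3.Theorems.Transplant

end
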